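import Literature.AnabelianGeometry.EtaleTheta.SettingModelFreeGroup
import Literature.AnabelianGeometry.EtaleTheta.SettingModelGalois
import Literature.AnabelianGeometry.EtaleTheta.SettingFreeProfiniteWitness
import HarnessLib

/-!
# A model of the [EtTh] §1 root, part D: the tempered-curve layer `Π^tp_X = F₂ × Γ ↪ Π_X = F̂₂ × Γ̂`

Mochizuki, *The étale theta function …*, Publ. RIMS **45** (2009) [EtTh], §1, PRIMS PDF pp. 11–12
[cite: MochizukiEtTh2009, §1 p.12]: "`1 → Δ^tp_X → Π^tp_X → G_K → 1`", "`Δ_X` … is a profinite free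
group on 2 generators", "`Δ^Θ_X := Δ_X/[Δ_X,[Δ_X,Δ_X]]`". Layer L2 of the abc-iut cell, seat
abc-iut-L2-t1 (root owner); FOURTH file of the explicit inhabitant of the L2 root `ThetaSetting p`
(vacuity lane — consistency evidence only, NOT the tempered fundamental group of a curve; see
`SettingModelHeisenberg.lean`).

Contents: the inhabitant `curve p` of the L3 interface `SemiGraphs.TemperedCurve p` underlying the
model — `K := ℚ_p`, `Π^tp := Δ × Γ` with `Δ = F₂` and `Γ = G_{ℚ_p}` DISCRETE, augmentation = second
projection, `Π := F̂₂ × Γ̂` with `toHat = η × η_Γ` (injective; a profinite completion by part B), the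
profinite augmentation through `Γ̂ → G_{ℚ_p}`, and NO closed points (like
`SemiGraphs.TemperedAnabelianWitness`) — together with the facts the theta layer needs: `Δ_X = F̂₂ × 1`
(`deltaHat_eq`), hence `Δ_X ≃ₜ* F̂₂` is profinite free on two generators
(`isFreeProfiniteOnTwo_deltaHat`); the pulled-back closures `KEll ⊇ KTheta` of `[Δ_X,Δ_X]`,
`[[Δ_X,Δ_X],Δ_X]` (the kernels-to-be of `Π^tp_X ↠ (Π^tp_X)^ell`, `(Π^tp_X)^Θ`) are normal; and the
continuity lemma `⁅closure A, B⁆ ⊆ closure ⁅A, B⁆`. Instances only on the NEW synonym `Del`. Nothing of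
[EtTh] is asserted; no side is taken on [IUTchIII] Cor. 3.12.
-/

noncomputable section

namespace Literature.AnabelianGeometry.EtaleTheta.SettingModel

open Literature.AnabelianGeometry.SemiGraphs
open CategoryTheory
open scoped commutatorElement

/-! ### A continuity lemma for commutators -/

/-- `⁅a, b⁆ ∈ closure ⁅A, B⁆` for `a ∈ closure A`, `b ∈ B` (continuity of `x ↦ ⁅x, b⁆`). [folklore] -/
private theorem commutatorElement_mem_closure {G : Type*} [Group G] [TopologicalSpace G]
    [IsTopologicalGroup G] (A B : Subgroup G) {a b : G} (ha : a ∈ A.topologicalClosure) (hb : b ∈ B) :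
    ⁅a, b⁆ ∈ (⁅A, B⁆).topologicalClosure := by
  have hcont : Continuous fun x : G => ⁅x, b⁆ := by
    simp only [commutatorElement_def]
    fun_prop
  have hsub : (A : Set G) ⊆ (fun x : G => ⁅x, b⁆) ⁻¹' ((⁅A, B⁆).topologicalClosure : Set G) :=
    fun x hx => Subgroup.le_topologicalClosure _ (Subgroup.commutator_mem_commutator hx hb)
  have hcl := closure_minimal hsub ((Subgroup.isClosed_topologicalClosure _).preimage hcont)
  have ha' : a ∈ (A.topologicalClosure : Set G) := ha
  rw [Subgroup.topologicalClosure_coe] at ha'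
  exact hcl ha'

/-- A continuous homomorphism maps the closure of a subgroup into the closure of its image. [folklore] -/
private theorem map_mem_topologicalClosure_map {G G' : Type*} [Group G] [TopologicalSpace G]
    [IsTopologicalGroup G] [Group G'] [TopologicalSpace G'] [IsTopologicalGroup G'] (f : G →* G')
    (hf : Continuous f) {H : Subgroup G} {x : G} (hx : x ∈ H.topologicalClosure) :
    f x ∈ (H.map f).topologicalClosure := by
  have hx' : x ∈ closure (H : Set G) := by
    have : x ∈ (H.topologicalClosure : Set G) := hx
    rwa [Subgroup.topologicalClosure_coe] at this
  have h2 := image_closure_subset_closure_image hf ⟨x, hx', rfl⟩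
  show f x ∈ ((H.map f).topologicalClosure : Set G')
  rw [Subgroup.topologicalClosure_coe, Subgroup.coe_map]
  exact h2

variable (p : ℕ) [Fact p.Prime]

/-! ### The discrete geometric factor `Δ = F₂` and the product `Π^tp = Δ × Γ` -/

/-- `Δ := F₂` as a DISCRETE topological group — the geometric factor of the model's `Π^tp_X`
("`Δ^tp_X`", [EtTh] p. 12). [cite: MochizukiEtTh2009, §1 p.12] -/
def Del : Type := F₂

/-- [folklore] -/ instance : Group Del := inferInstanceAs (Group F₂)
/-- [folklore] -/ instance : TopologicalSpace Del := ⊥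
/-- [folklore] -/ instance : DiscreteTopology Del := ⟨rfl⟩

/-- The identity `Δ → F₂`. [cite: MochizukiEtTh2009, §1 p.12] -/
def Del.val : Del →* F₂ where
  toFun g := g
  map_one' := rfl
  map_mul' _ _ := rfl

/-- [cite: MochizukiEtTh2009, §1 p.12] -/
theorem Del.val_bijective : Function.Bijective Del.val := Function.bijective_id

/-- The identity `F₂ → Δ`. [cite: MochizukiEtTh2009, §1 p.12] -/
def Del.ofF₂ : F₂ →* Del where
  toFun g := g
  map_one' := rfl
  map_mul' _ _ := rfl

/-- [cite: MochizukiEtTh2009, §1 p.12] -/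
theorem Del.val_ofF₂ (g : F₂) : Del.val (Del.ofF₂ g) = g := rfl

/-- `Π^tp_X := Δ × Γ` (discrete), the model's tempered fundamental group. [cite: MochizukiEtTh2009, §1 p.12] -/
abbrev PiTp : Type := Del × Gam p

/-- The carrier of `F̂₂`. [cite: MochizukiEtTh2009, §1 p.12] -/
abbrev F₂hatT : Type := F₂hat

/-- The carrier of `Γ̂`. [cite: MochizukiEtTh2009, §1 p.12] -/
abbrev GamHatT : Type := GamHat p

/-- `Π_X := F̂₂ × Γ̂`, the model's profinite fundamental group. [cite: MochizukiEtTh2009, §1 p.12] -/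
abbrev PiHt : Type := F₂hatT × GamHatT p

/-- `Π^tp_X → Π_X`, `= η × η_Γ`. [cite: MochizukiEtTh2009, §1 p.12] -/
def toHatM : PiTp p →ₜ* PiHt p := (etaCont Del).prodMap (etaCont (Gam p))

/-- [cite: MochizukiEtTh2009, §1 p.12] -/
theorem toHatM_apply (g : PiTp p) : toHatM p g = (eta (Del.val g.1), etaGam p g.2) := rfl

/-- The augmentation `Π^tp_X → G_{ℚ_p}`: the second projection. [cite: MochizukiEtTh2009, §1 p.12] -/
def augM : PiTp p →ₜ* GQp p := (Gam.toGQp p).comp (ContinuousMonoidHom.snd Del (Gam p))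

/-- The profinite augmentation `Π_X → G_{ℚ_p}`: `Γ̂ → G_{ℚ_p}` after the second projection.
[cite: MochizukiEtTh2009, §1 p.12] -/
def augHatM : PiHt p →ₜ* GQp p :=
  (augHatGam p).comp (ContinuousMonoidHom.snd F₂hatT (GamHatT p))

/-- [cite: MochizukiEtTh2009, §1 p.12] -/
theorem augM_apply (g : PiTp p) : augM p g = Gam.toGQp p g.2 := rfl

/-! ### The inhabitant of `TemperedCurve p` -/

/-- **The tempered-curve layer of the model**: `K := ℚ_p`, `Π^tp := F₂ × G_{ℚ_p}` (discrete),
`Π := F̂₂ × Ĝ_{ℚ_p}`, no closed points (the decomposition-group clauses hold vacuously). An inhabitant of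
the [SemiAnbd] §6 interface extending `SemiGraphs.TemperedAnabelianWitness` to a NON-compact `Π^tp`.
[cite: MochizukiEtTh2009, §1 p.11] -/
abbrev curve : TemperedCurve p where
  K := ⊥
  finiteDimensional_K := inferInstance
  PiTemp := PiTp p
  aug := augM p
  range_aug := by
    rw [IntermediateField.fixingSubgroup_bot]
    exact MonoidHom.range_eq_top.mpr fun σ => ⟨((1 : Del), (σ : Gam p)), rfl⟩
  PiHat := PiHt p
  toHat := toHatM p
  isProfiniteCompletion_toHat := isProfiniteCompletion_prodMap_etaCont Del (Gam p)
  toHat_injective := eta_injective.prodMap (etaGam_injective p)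
  augHat := augHatM p
  augHat_comp g := augHatGam_etaGam p g.2
  Pt := PEmpty
  IsCusp _ := False
  decomp x := x.elim
  isClosed_decomp x := x.elim
  isOpen_aug_decomp x := x.elim
  inertia_eq_bot x := x.elim
  inertia_equiv_zHat x := x.elim

/-- [cite: MochizukiEtTh2009, §1 p.12] -/
theorem curve_K : (curve p).K = ⊥ := rfl

/-- `Δ^tp_X = Ker(aug) = {(g, 1)}`. [cite: MochizukiEtTh2009, §1 p.12] -/
theorem mem_deltaTemp_iff (g : PiTp p) : g ∈ (curve p).DeltaTemp ↔ g.2 = 1 := Iff.rfl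

/-- `Δ^tp_X = Δ × 1`. [cite: MochizukiEtTh2009, §1 p.12] -/
theorem deltaTemp_eq : (curve p).DeltaTemp = (⊤ : Subgroup Del).prod (⊥ : Subgroup (Gam p)) := by
  ext g
  rw [mem_deltaTemp_iff, Subgroup.mem_prod, Subgroup.mem_bot]
  simp

/-- `F̂₂ × 1` is closed in `Π_X`. [folklore] -/
private theorem isClosed_prod_bot :
    IsClosed (((⊤ : Subgroup F₂hatT).prod (⊥ : Subgroup (GamHatT p)) : Subgroup (PiHt p)) :
      Set (PiHt p)) := by
  have : (((⊤ : Subgroup F₂hatT).prod (⊥ : Subgroup (GamHatT p)) : Subgroup (PiHt p)) :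
      Set (PiHt p)) = Set.univ ×ˢ {1} := by
    ext x
    simp [Subgroup.mem_prod, Subgroup.mem_bot]
  rw [this]
  exact isClosed_univ.prod isClosed_singleton

/-- **`Δ_X = F̂₂ × 1`**: the closure of the image of `Δ^tp_X = F₂ × 1` in `Π_X = F̂₂ × Γ̂` (density of
`F₂ ↪ F̂₂`). [cite: MochizukiEtTh2009, §1 p.12] -/
theorem deltaHat_eq : (curve p).DeltaHat = (⊤ : Subgroup F₂hatT).prod (⊥ : Subgroup (GamHatT p)) := by
  apply le_antisymm
  · refine Subgroup.topologicalClosure_minimal _ ?_ (isClosed_prod_bot p)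
    rintro _ ⟨g, hg, rfl⟩
    have hg' : g.2 = 1 := (mem_deltaTemp_iff p g).mp hg
    refine ⟨trivial, ?_⟩
    show etaGam p g.2 ∈ (⊥ : Subgroup _)
    rw [hg', map_one]
    exact Subgroup.one_mem _
  · rintro ⟨x, y⟩ hxy
    obtain ⟨-, hy⟩ := Subgroup.mem_prod.mp hxy
    rw [Subgroup.mem_bot] at hy
    subst hy
    have hsub : Set.range eta ×ˢ ({1} : Set (GamHatT p)) ⊆
        (((curve p).DeltaTemp.map (curve p).toHat.toMonoidHom : Subgroup (PiHt p)) : Set (PiHt p)) := by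
      rintro ⟨a, b⟩ ⟨⟨g, rfl⟩, hb⟩
      rw [Set.mem_singleton_iff] at hb
      subst hb
      refine ⟨((g : Del), (1 : Gam p)), (mem_deltaTemp_iff p _).mpr rfl, ?_⟩
      show ((eta g, etaCont (Gam p) 1) : PiHt p) = (eta g, 1)
      rw [map_one]
    have hx : ((x, 1) : PiHt p) ∈ closure (Set.range eta ×ˢ ({1} : Set (GamHatT p))) := by
      rw [closure_prod_eq, Set.mem_prod]
      exact ⟨denseRange_eta x, subset_closure rfl⟩
    have key := closure_mono hsub hx
    rwa [← Subgroup.topologicalClosure_coe] at key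

/-- Elements of `Δ_X` have trivial `Γ̂`-component. [cite: MochizukiEtTh2009, §1 p.12] -/
theorem snd_eq_one_of_mem_deltaHat {x : PiHt p} (hx : x ∈ (curve p).DeltaHat) : x.2 = 1 := by
  rw [deltaHat_eq] at hx
  exact (Subgroup.mem_bot).mp hx.2

/-- `(x, 1) ∈ Δ_X` for every `x ∈ F̂₂`. [cite: MochizukiEtTh2009, §1 p.12] -/
theorem mk_one_mem_deltaHat (x : F₂hatT) : ((x, 1) : PiHt p) ∈ (curve p).DeltaHat := by
  rw [deltaHat_eq]
  exact ⟨trivial, (Subgroup.mem_bot).mpr rfl⟩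

/-- `Δ_X` is normal in `Π_X`. [cite: MochizukiEtTh2009, §1 p.12] -/
theorem deltaHat_normal : (curve p).DeltaHat.Normal := by
  rw [deltaHat_eq]
  infer_instance

/-- **`Δ_X ≃ F̂₂`** as topological groups (`x ↦ (x, 1)`). [cite: MochizukiEtTh2009, §1 p.12] -/
def deltaHatEquiv : F₂hatT ≃ₜ* (curve p).DeltaHat where
  toFun x := ⟨(x, 1), mk_one_mem_deltaHat p x⟩
  invFun y := (Subtype.val y).1
  left_inv x := rfl
  right_inv y := by
    apply Subtype.ext
    exact Prod.ext rfl (snd_eq_one_of_mem_deltaHat p y.2).symm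
  map_mul' x y := rfl
  continuous_toFun := by
    apply Continuous.subtype_mk
    exact continuous_id.prodMk continuous_const
  continuous_invFun := continuous_fst.comp continuous_subtype_val

/-- `IsFreeProfiniteOnTwo` is invariant under isomorphisms of topological groups. [cite: MochizukiEtTh2009, §1 p.12] -/
theorem IsFreeProfiniteOnTwo.of_continuousMulEquiv {P P' : Type} [Group P] [TopologicalSpace P]
    [Group P'] [TopologicalSpace P'] (e : P ≃ₜ* P') (h : IsFreeProfiniteOnTwo P) :
    IsFreeProfiniteOnTwo P' := by
  obtain ⟨hc, ht, htd, a, b, huniv⟩ := h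
  haveI := hc; haveI := ht; haveI := htd
  refine ⟨e.toHomeomorph.compactSpace, e.toHomeomorph.t2Space,
    Homeomorph.totallyDisconnectedSpace e.toHomeomorph, e a, e b, ?_⟩
  intro Q _ _ _ _ x y
  obtain ⟨f, ⟨hfa, hfb⟩, huniq⟩ := huniv Q x y
  refine ⟨f.comp (e.symm : P' →ₜ* P), ⟨?_, ?_⟩, fun g ⟨hga, hgb⟩ => ?_⟩
  · show f ((e.symm : P' →ₜ* P) (e a)) = x
    rw [ContinuousMonoidHom.coe_coe, e.symm_apply_apply, hfa]
  · show f ((e.symm : P' →ₜ* P) (e b)) = y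
    rw [ContinuousMonoidHom.coe_coe, e.symm_apply_apply, hfb]
  · have hg : g.comp (e : P →ₜ* P') = f :=
      huniq (g.comp (e : P →ₜ* P')) ⟨by simpa using hga, by simpa using hgb⟩
    ext z
    have hz := DFunLike.congr_fun hg (e.symm z)
    simp only [ContinuousMonoidHom.comp_toFun, ContinuousMonoidHom.coe_coe,
      e.apply_symm_apply] at hz
    simp only [ContinuousMonoidHom.comp_toFun, ContinuousMonoidHom.coe_coe]
    exact hz

/-- **`Δ_X` of the model is profinite free on two generators** (transport of abc-iut-w5-d218's
`isFreeProfiniteOnTwo_profiniteCompletion_freeGroup` along `Δ_X ≃ F̂₂`) — the guard field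
`IsEtThOrigin.deltaHat_free` ([EtTh] p. 12). [cite: MochizukiEtTh2009, §1 p.12] -/
theorem isFreeProfiniteOnTwo_deltaHat : IsFreeProfiniteOnTwo (curve p).DeltaHat :=
  IsFreeProfiniteOnTwo.of_continuousMulEquiv (deltaHatEquiv p)
    isFreeProfiniteOnTwo_profiniteCompletion_freeGroup

/-! ### The pulled-back closures of `[Δ_X, Δ_X]` and `[[Δ_X, Δ_X], Δ_X]` -/

/-- `KEll := toHat⁻¹([Δ_X, Δ_X]⁻)` — the kernel-to-be of `Π^tp_X ↠ (Π^tp_X)^ell` ("induced by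
`Δ_X ↠ Δ^ell_X = Δ_X/[Δ_X,Δ_X]`", p. 12). [cite: MochizukiEtTh2009, §1 p.12] -/
def KEll : Subgroup (PiTp p) :=
  (⁅(curve p).DeltaHat, (curve p).DeltaHat⁆.topologicalClosure).comap (curve p).toHat.toMonoidHom

/-- `KTheta := toHat⁻¹([[Δ_X, Δ_X], Δ_X]⁻)` — the kernel-to-be of `Π^tp_X ↠ (Π^tp_X)^Θ` ("induced by
`Δ_X ↠ Δ^Θ_X := Δ_X/[Δ_X,[Δ_X,Δ_X]]`", p. 12). [cite: MochizukiEtTh2009, §1 p.12] -/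
def KTheta : Subgroup (PiTp p) :=
  (⁅⁅(curve p).DeltaHat, (curve p).DeltaHat⁆, (curve p).DeltaHat⁆.topologicalClosure).comap
    (curve p).toHat.toMonoidHom

/-- [folklore] -/
instance KEll_normal : (KEll p).Normal := by
  haveI := deltaHat_normal p
  unfold KEll
  haveI : (⁅(curve p).DeltaHat, (curve p).DeltaHat⁆.topologicalClosure).Normal :=
    Subgroup.is_normal_topologicalClosure _
  exact Subgroup.Normal.comap inferInstance _

/-- [folklore] -/
instance KTheta_normal : (KTheta p).Normal := by
  haveI := deltaHat_normal p
  unfold KTheta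
  haveI : (⁅⁅(curve p).DeltaHat, (curve p).DeltaHat⁆, (curve p).DeltaHat⁆.topologicalClosure).Normal :=
    Subgroup.is_normal_topologicalClosure _
  exact Subgroup.Normal.comap inferInstance _

/-- `[Δ_X,Δ_X]⁻ ≤ Δ_X` (closed subgroup). [cite: MochizukiEtTh2009, §1 p.12] -/
theorem commutatorClosure_le_deltaHat :
    (⁅(curve p).DeltaHat, (curve p).DeltaHat⁆).topologicalClosure ≤ (curve p).DeltaHat := by
  haveI := deltaHat_normal p
  refine Subgroup.topologicalClosure_minimal _ (Subgroup.commutator_le_left _ _) ?_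
  rw [deltaHat_eq]
  exact isClosed_prod_bot p

/-- `KTheta ≤ KEll` (`[[Δ,Δ],Δ] ≤ [Δ,Δ]`). [cite: MochizukiEtTh2009, §1 p.12] -/
theorem KTheta_le_KEll : KTheta p ≤ KEll p := by
  haveI := deltaHat_normal p
  refine Subgroup.comap_mono (Subgroup.topologicalClosure_mono ?_)
  exact Subgroup.commutator_mono (Subgroup.commutator_le_left _ _) le_rfl

/-- For `a ∈ KEll`, `b` with `toHat b ∈ Δ_X`: `⁅a, b⁆ ∈ KTheta` (continuity of commutators). The common
core of "`Δ_Θ` is commutative" and "central in `(Δ^tp_X)^Θ`" (p. 12). [cite: MochizukiEtTh2009, §1 p.12] -/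
theorem commutatorElement_mem_KTheta {a b : PiTp p} (ha : a ∈ KEll p)
    (hb : (curve p).toHat b ∈ (curve p).DeltaHat) : ⁅a, b⁆ ∈ KTheta p := by
  have ha' : (curve p).toHat.toMonoidHom a ∈
      (⁅(curve p).DeltaHat, (curve p).DeltaHat⁆).topologicalClosure := ha
  have hb' : (curve p).toHat.toMonoidHom b ∈ (curve p).DeltaHat := hb
  have key := commutatorElement_mem_closure _ _ ha' hb'
  rw [← map_commutatorElement] at key
  exact key

/-- `toHat b ∈ Δ_X` for `b ∈ KEll`. [cite: MochizukiEtTh2009, §1 p.12] -/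
theorem toHat_mem_deltaHat_of_mem_KEll {b : PiTp p} (hb : b ∈ KEll p) :
    (curve p).toHat b ∈ (curve p).DeltaHat :=
  commutatorClosure_le_deltaHat p hb

/-- `toHat b ∈ Δ_X` for `b ∈ Δ^tp_X`. [cite: MochizukiEtTh2009, §1 p.12] -/
theorem toHat_mem_deltaHat_of_mem_deltaTemp {b : PiTp p} (hb : b ∈ (curve p).DeltaTemp) :
    (curve p).toHat b ∈ (curve p).DeltaHat :=
  Subgroup.le_topologicalClosure _ ⟨b, hb, rfl⟩

/-- **`KTheta ⊆ Ker(F₂ → Heis ℤ) × 1`**: an element of `Π^tp_X` whose image lies in `[[Δ_X,Δ_X],Δ_X]⁻`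
has trivial `Γ`-component and dies in the Heisenberg group (part B's class-2 shadow). The model's form
of "`Z_N` is cut out inside the theta quotient" (p. 14). [cite: MochizukiEtTh2009, §1 p.14] -/
theorem heisHom_eq_one_and_snd_eq_one_of_mem_KTheta {g : PiTp p} (hg : g ∈ KTheta p) :
    heisHom (Del.val g.1) = 1 ∧ g.2 = 1 := by
  haveI := deltaHat_normal p
  have hmem : (curve p).toHat g ∈
      (⁅⁅(curve p).DeltaHat, (curve p).DeltaHat⁆, (curve p).DeltaHat⁆).topologicalClosure := hg
  constructor
  · -- project to `F̂₂` along the continuous first projection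
    have hle : (⁅⁅(curve p).DeltaHat, (curve p).DeltaHat⁆, (curve p).DeltaHat⁆ : Subgroup (PiHt p)) ≤
        ⁅⁅(⊤ : Subgroup (PiHt p)), (⊤ : Subgroup (PiHt p))⁆, (⊤ : Subgroup (PiHt p))⁆ :=
      Subgroup.commutator_mono (Subgroup.commutator_mono le_top le_top) le_top
    have h1 := Subgroup.topologicalClosure_mono hle hmem
    have h2 := map_mem_topologicalClosure_map (MonoidHom.fst F₂hatT (GamHatT p)) continuous_fst h1
    have hsurj : Function.Surjective (MonoidHom.fst F₂hatT (GamHatT p)) := fun x => ⟨(x, 1), rfl⟩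
    rw [Subgroup.map_commutator, Subgroup.map_commutator, Subgroup.map_top_of_surjective _ hsurj] at h2
    have hfst : (MonoidHom.fst F₂hatT (GamHatT p)) ((curve p).toHat g) = eta (Del.val g.1) := rfl
    rw [hfst] at h2
    exact heisHom_eq_one_of_eta_mem_closure (Del.val g.1) h2
  · have h1 := snd_eq_one_of_mem_deltaHat p
      ((Subgroup.topologicalClosure_minimal _
        (Subgroup.commutator_le_right _ (curve p).DeltaHat)
        (by rw [deltaHat_eq]; exact isClosed_prod_bot p)) hmem)
    exact etaGam_injective p (by rw [map_one]; exact h1)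

end Literature.AnabelianGeometry.EtaleTheta.SettingModel

end
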